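import Summits.QuantumFields.BalabanUV.Beta.GAN24.OneStepConstraintAxialGauges

/-!
# `BalabanUV.Beta.GAN24.OneStepConstraintAxialLocalisation` — binder row G-an2-4 ∕ (CONV-C), routes C-R6° («VALUES») × R7 («TWO CURRENCIES»), PART 180 (file 2 of 2):
# S2′(h) FOR THE STACKED ONE-STEP CONSTRAINT `Q_ax = fromRows (re QB N R M) E` — THE SOFT LETTER FOR `K = H + Q_axᵀ(a•1)Q_ax` AND THE THREE ENDs: the effective form
# `𝒮 = effForm H Q_ax`, the hard minimiser `ℋ = minOp H Q_ax` and the GAUGE-FIXED fluctuation covariance `𝒢 = flucCov H Q_ax` (Bałaban's `C(CᵀHC)⁻¹Cᵀ` of (2.156)) decay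
# exponentially in the block distance, for EVERY symmetric fine form `H` with `0 ≤ ⟨u,Hu⟩ ≤ h|u|²` and block-decaying entries, every `a > 0`, every bond family `ι` avoiding the
# top corners, and every coercivity constant `γ_K` of `K` (PART 178 ∕ 179 supply it from (2.153)) — census V200″ (δ), (UD) half
# (unit b2b-balaban-gan24-p3, gen 60; v1)

NOT IN PRINT; OUR PROOF ([folklore] composition BY NAME: PART 105 `EffectiveFormLocalisation` (`abs_effForm_le`, `abs_minOp_le`, `abs_blockProp_le_of_resolvent`, `abs_inv_mul_transpose_le_of_resolvent`,
`transpose_reg`), PART 106 `FluctuationCovarianceLocalisation.abs_flucCov_le`, t4-ne9-formalise-leaf-04's `FP.WellConditionedInverseLocality.abs_inv_le_of_coercive_localised` (finite Combes–Thomas ∕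
[B4] Sect. 5 step), PART 168 `OneStepConstraintLetters` (`reM_QB_mulVec_cornerLift`, `cornerLift_dotProduct_self`), PART 170 `OneStepConstraintLocalisation` (`isPseudoDist_fine`, `sumBound_fine`),
PART 177 `StackedConstraintLetters` (`fromRows_mulVec_stackedLift`, `stackedLift_mass`, `proj_mulVec`, `proj_mulVec_ext`, `ext_dotProduct_self`), PART 178 `OneStepConstraintAxialLetters.dotProduct_reM_QB_ext_le`,
and file 1 `OneStepConstraintAxialGauges`.  [Balaban1984PropagatorsII] (2.121) p. 244, (2.152)–(2.157) pp. 249–250 LOCATE the objects (`C(C*Δ_kC)⁻¹C*`); nothing printed is a hypothesis.)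
HONEST FRAMING (cell contract, verbatim): «discharging `BetaPertH` makes Bałaban's UV stability UNCONDITIONAL — a real constructive-QFT result; it is NOT the continuum limit
and NOT the Clay problem.»  HONEST DEPENDENCY (verbatim): «continuum YM on T⁴ ⇐ BetaPertH ∧ nine spine estimates (0/9 proved); BetaPertH ⇐ (D1) ∧ (D4) ∧ CAP+tail; G-an2-4 gates
asym, D1 and NE2/3/4.»

WHY (census V200″ (δ), gen 59): «PART 170 ∕ 172-type (UD)+(SR) ENDs for 𝒮, ℋ, 𝒢 = flucCov(re Δ_k, Q_ax) — the lineage's generic PARTs 105–107 ∕ 113–114 apply verbatim» once the letters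
of the stacked constraint are typed (file 1).  THIS FILE is the (UD) half, generic in the fine form `H` and in the family `ι`; its instantiation `ι = the axial tree`, `H = re Δ_k` (with
PART 179's `coercive_reg_DelK_axial` as `hK`) is the next PART.

THE CONSTANTS (displayed as equations; instantiate with `rfl`): `γ_K` FREE (any coercivity constant of `K`; PART 178's `(max (4∕γ₀) ((4h·e₂∕γ₀ + 2e₂)∕a))⁻¹` is the intended one),
`c_K = (h₀ + a·R^{−d}R^{−d}·e^{2δ_H}) + a`, `r_F = rate (s ↦ d·R^d·Kf s) γ_K c_K δ_H`, `c₀ = (2∕γ_K)e^{2r_F}`, `c₁ = (2∕γ_K)e^{r_F}`, `e₂ = 4R^{2d}(1 + R^{−d}) + 2·1`, `Λ = h·e₂`,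
`r_U = rate (s ↦ d(1+R^d)·Kf s) (Λ+a)⁻¹ c₀ r_F`, `m = min r_F r_U`; gauges as in file 1 (`key = Sum.elim (·.1) (par ∘ ι)` spelled inline).
WHAT THIS FILE PROVES (0 sorry, 0 `def`; `N, R ≥ 1`, every torus `M`, every `d`, every finite `T` with `ι : T ↪ Tor (fine (R·N) M) × Fin d`):
* §1 **`abs_inv_regFormAx_le`** (`|K⁻¹(x,x′)| ≤ (2∕γ_K)e^{−r_F·tdist(par x, par x′)}`), **`abs_blockProp_le_QB_axial`** (`|(Q_axK⁻¹Q_axᵀ)(b,b′)| ≤ c₀e^{−r_F·ρ}`),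
  **`abs_inv_mul_transpose_le_QB_axial`** (`|(K⁻¹Q_axᵀ)(x,b)| ≤ c₁e^{−r_F·σ}`).
* §2 **`ub_QB_axial`** (PART 105's `hUB` with `Λ = h·e₂`, for every family AVOIDING THE TOP CORNERS — the tree does, PART 178 `cornerLift_apply_of_tree`), and the ENDs
  **`abs_effForm_le_QB_axial`** (`|𝒮(b,b′)| ≤ (2(Λ+a)+a)·e^{−r_U·ρ(b,b′)}`), **`abs_minOp_le_QB_axial`** (`|ℋ(x,b)| ≤ 2(Λ+a)·c₁·(d(1+R^d)Kf(m∕2))·e^{−(m∕2)σ(x,b)}`),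
  **`abs_flucCov_le_QB_axial`** (`|𝒢(x,x′)| ≤ (2∕γ_K + 2(Λ+a)c₁²(d(1+R^d)Kf(m∕2))(d(1+R^d)Kf(m∕4)))·e^{−min r_F (m∕4)·tdist(par x, par x′)}`).
WHAT IT IS NOT: the coercivity `γ_K` is an INPUT here (PART 178 `coercive_reg_QB_axial` from a (2.153)-shape kernel coercivity; PART 179 `coercive_reg_DelK_axial` for `H = re Δ_k`); the
model-side letters `h, h₀, δ_H` and the profile `Kf` are inputs (`VectorTailsCov.sum_exp_tdist_le`); the instantiation `T = tree bonds, H = re Δ_k` is the next PART; the RATE half (PART 172's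
pattern) and EL₂ are untouched.  SUPPLIER work; NEVER «G-an2-4 closed»; NOT (CONV-C), NOT D1, NOT `BetaPertH`, NOT continuum, NOT Clay.  Records: `HOME/b2b-balaban-gan24-p3/gen60/README.md`.
-/

noncomputable section

open scoped BigOperators Matrix
open Finset Matrix

namespace Summit.QuantumFields.BalabanUV.Beta.GAN24.OneStepConstraintAxialLocalisation

open Literature.MathematicalPhysics.QuantumFieldTheory.Balaban1983to89
open Literature.MathematicalPhysics.QuantumFieldTheory.Balaban1983to89.B4Sect5Torus (IsPseudoDist SumBound rate rate_pos)
open Literature.MathematicalPhysics.QuantumFieldTheory.Balaban1983to89.Beta.Composition (blockProp)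
open Literature.MathematicalPhysics.QuantumFieldTheory.Balaban1983to89.Beta.CompositionSingular (effForm minOp flucCov)
open Literature.MathematicalPhysics.QuantumFieldTheory.Balaban1983to89.B5Prop11Plancherel (Tor fine)
open Literature.MathematicalPhysics.QuantumFieldTheory.Balaban1983to89.B5RealFields (reM)
open Literature.MathematicalPhysics.QuantumFieldTheory.Balaban1983to89.Beta.VectorTailsCov (tdist tdist_self tdist_triangle tdist_comm)
open Summit.QuantumFields.BalabanUV.T4Continuum.BalabanLineAverage (QB)
open Summit.QuantumFields.BalabanUV.T4Continuum.BalabanAveragedTowerModes (par rem)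
open Summit.QuantumFields.BalabanUV.Beta.FP.WellConditionedInverseLocality (abs_inv_le_of_coercive_localised)
open Summit.QuantumFields.BalabanUV.Beta.GAN24.EffectiveFormLocalisation (transpose_reg abs_effForm_le abs_minOp_le abs_blockProp_le_of_resolvent abs_inv_mul_transpose_le_of_resolvent)
open Summit.QuantumFields.BalabanUV.Beta.GAN24.FluctuationCovarianceLocalisation (abs_flucCov_le)
open Summit.QuantumFields.BalabanUV.Beta.GAN24.OneStepConstraintLetters (reM_QB_mulVec_cornerLift cornerLift_dotProduct_self)
open Summit.QuantumFields.BalabanUV.Beta.GAN24.OneStepConstraintLocalisation (isPseudoDist_fine sumBound_fine)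
open Summit.QuantumFields.BalabanUV.Beta.GAN24.StackedConstraintLetters (proj_mulVec proj_mulVec_ext ext_dotProduct_self fromRows_mulVec_stackedLift stackedLift_mass)
open Summit.QuantumFields.BalabanUV.Beta.GAN24.OneStepConstraintAxialLetters (dotProduct_reM_QB_ext_le)
open Summit.QuantumFields.BalabanUV.Beta.GAN24.OneStepConstraintAxialGauges (isPseudoDist_key sumBound_key sum_exp_sigma_key_le sum_abs_fromRows_row tdist_key_le_tdist_par_add_two
  tdist_par_key_le_tdist_par_add_one abs_regFormAx_apply_le)

variable {d : ℕ} (N R : ℕ) [NeZero N] [NeZero R] (M : Fin d → ℕ) [hM : ∀ μ, NeZero (M μ)]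
variable {T : Type*} [Fintype T] [DecidableEq T] (ι : T ↪ Tor (fine (R * N) M) × Fin d)

/-! ## §1 The soft letter and PART 105 §4's two unit letters for the stacked constraint -/

section Soft

variable {H : Matrix (Tor (fine (R * N) M) × Fin d) (Tor (fine (R * N) M) × Fin d) ℝ} {Kf : ℝ → ℝ}

/-- **`abs_inv_regFormAx_le` — THE SOFT LETTER FOR THE STACKED CONSTRAINT** [our proof; finite Combes–Thomas `abs_inv_le_of_coercive_localised` on the fine gauge with profile `d·R^d·Kf`,
the coercivity `γ_K` of `K` as INPUT (PART 178 ∕ 179), and `abs_regFormAx_apply_le`]: `|K⁻¹(x,x′)| ≤ (2∕γ_K)·e^{−r_F·tdist(par x, par x′)}`, `r_F = rate (s ↦ d·R^d·Kf s) γ_K c_K δ_H`. -/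
theorem abs_inv_regFormAx_le (hKf0 : ∀ s : ℝ, 0 < s → 0 ≤ Kf s)
    (hKf : ∀ s : ℝ, 0 < s → ∀ y : Tor (fine N M), ∑ y' : Tor (fine N M), Real.exp (-(s * (tdist y y' : ℝ))) ≤ Kf s)
    (hH : Hᵀ = H) {γK : ℝ} (hγK : 0 < γK) {a h₀ δH : ℝ} (ha : 0 < a) (hh₀ : 0 ≤ h₀) (hδH : 0 < δH)
    (hK : QGQInverse.Coercive
      (H + (Matrix.fromRows (reM (QB N R M)) (fun (t : T) (x : Tor (fine (R * N) M) × Fin d) => if x = ι t then (1 : ℝ) else 0))ᵀ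
          * (a • (1 : Matrix ((Tor (fine N M) × Fin d) ⊕ T) ((Tor (fine N M) × Fin d) ⊕ T) ℝ))
          * Matrix.fromRows (reM (QB N R M)) (fun (t : T) (x : Tor (fine (R * N) M) × Fin d) => if x = ι t then (1 : ℝ) else 0)) γK)
    (hHent : ∀ x x', |H x x'| ≤ h₀ * Real.exp (-(δH * (tdist (par N R M x.1) (par N R M x'.1) : ℝ))))
    {cK rF : ℝ} (hcK : cK = (h₀ + a * (((R : ℝ) ^ d)⁻¹ * ((R : ℝ) ^ d)⁻¹) * Real.exp (2 * δH)) + a)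
    (hrF : rF = rate (fun s => (d : ℝ) * (R : ℝ) ^ d * Kf s) γK cK δH) (x x' : Tor (fine (R * N) M) × Fin d) :
    |(H + (Matrix.fromRows (reM (QB N R M)) (fun (t : T) (x : Tor (fine (R * N) M) × Fin d) => if x = ι t then (1 : ℝ) else 0))ᵀ
          * (a • (1 : Matrix ((Tor (fine N M) × Fin d) ⊕ T) ((Tor (fine N M) × Fin d) ⊕ T) ℝ))
          * Matrix.fromRows (reM (QB N R M)) (fun (t : T) (x : Tor (fine (R * N) M) × Fin d) => if x = ι t then (1 : ℝ) else 0))⁻¹ x x'| ≤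
      2 / γK * Real.exp (-(rF * (tdist (par N R M x.1) (par N R M x'.1) : ℝ))) := by
  have hcK0 : 0 ≤ cK := by rw [hcK]; positivity
  have hprof : ∀ s : ℝ, 0 < s → 0 ≤ (d : ℝ) * (R : ℝ) ^ d * Kf s := fun s hs => by have := hKf0 s hs; positivity
  have h := abs_inv_le_of_coercive_localised hprof (isPseudoDist_fine N R M) (sumBound_fine N R M hKf) (transpose_reg hH a) hγK hcK0 hδH hK
    (fun p q => by rw [hcK]; exact abs_regFormAx_apply_le N R M ι ha.le hδH.le hHent p q) x x'
  rwa [← hrF] at h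

/-- **`abs_blockProp_le_QB_axial` — THE STACKED BLOCK PROPAGATOR `P = Q_axK⁻¹Q_axᵀ` IS LOCALISED IN THE KEY DISTANCE**: `|P(b,b′)| ≤ (2∕γ_K)e^{2r_F}·e^{−r_F·tdist(key b, key b′)}`
(PART 105 §4 with `q₁ = 1`, `R = 2`). [folklore] -/
theorem abs_blockProp_le_QB_axial (hKf0 : ∀ s : ℝ, 0 < s → 0 ≤ Kf s)
    (hKf : ∀ s : ℝ, 0 < s → ∀ y : Tor (fine N M), ∑ y' : Tor (fine N M), Real.exp (-(s * (tdist y y' : ℝ))) ≤ Kf s)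
    (hH : Hᵀ = H) {γK : ℝ} (hγK : 0 < γK) {a h₀ δH : ℝ} (ha : 0 < a) (hh₀ : 0 ≤ h₀) (hδH : 0 < δH)
    (hK : QGQInverse.Coercive
      (H + (Matrix.fromRows (reM (QB N R M)) (fun (t : T) (x : Tor (fine (R * N) M) × Fin d) => if x = ι t then (1 : ℝ) else 0))ᵀ
          * (a • (1 : Matrix ((Tor (fine N M) × Fin d) ⊕ T) ((Tor (fine N M) × Fin d) ⊕ T) ℝ))
          * Matrix.fromRows (reM (QB N R M)) (fun (t : T) (x : Tor (fine (R * N) M) × Fin d) => if x = ι t then (1 : ℝ) else 0)) γK)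
    (hHent : ∀ x x', |H x x'| ≤ h₀ * Real.exp (-(δH * (tdist (par N R M x.1) (par N R M x'.1) : ℝ))))
    {cK rF c₀ : ℝ} (hcK : cK = (h₀ + a * (((R : ℝ) ^ d)⁻¹ * ((R : ℝ) ^ d)⁻¹) * Real.exp (2 * δH)) + a)
    (hrF : rF = rate (fun s => (d : ℝ) * (R : ℝ) ^ d * Kf s) γK cK δH) (hc₀ : c₀ = 2 / γK * Real.exp (2 * rF)) (b b' : (Tor (fine N M) × Fin d) ⊕ T) :
    |blockProp (H + (Matrix.fromRows (reM (QB N R M)) (fun (t : T) (x : Tor (fine (R * N) M) × Fin d) => if x = ι t then (1 : ℝ) else 0))ᵀ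
          * (a • (1 : Matrix ((Tor (fine N M) × Fin d) ⊕ T) ((Tor (fine N M) × Fin d) ⊕ T) ℝ))
          * Matrix.fromRows (reM (QB N R M)) (fun (t : T) (x : Tor (fine (R * N) M) × Fin d) => if x = ι t then (1 : ℝ) else 0))
        (Matrix.fromRows (reM (QB N R M)) (fun (t : T) (x : Tor (fine (R * N) M) × Fin d) => if x = ι t then (1 : ℝ) else 0)) b b'| ≤
      c₀ * Real.exp (-(rF * (tdist (Sum.elim (fun b : Tor (fine N M) × Fin d => b.1) (fun t : T => par N R M (ι t).1) b)
                               (Sum.elim (fun b : Tor (fine N M) × Fin d => b.1) (fun t : T => par N R M (ι t).1) b') : ℝ))) := by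
  have hcK0 : 0 ≤ cK := by rw [hcK]; positivity
  have hprof : ∀ s : ℝ, 0 < s → 0 ≤ (d : ℝ) * (R : ℝ) ^ d * Kf s := fun s hs => by have := hKf0 s hs; positivity
  have hrF0 : 0 < rF := by rw [hrF]; exact rate_pos hprof hγK hcK0 hδH
  have hG := abs_inv_regFormAx_le N R M ι hKf0 hKf hH hγK ha hh₀ hδH hK hHent hcK hrF
  have h := abs_blockProp_le_of_resolvent
    (ρ := fun b b' : (Tor (fine N M) × Fin d) ⊕ T =>
      (tdist (Sum.elim (fun b : Tor (fine N M) × Fin d => b.1) (fun t : T => par N R M (ι t).1) b)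
             (Sum.elim (fun b : Tor (fine N M) × Fin d => b.1) (fun t : T => par N R M (ι t).1) b') : ℝ))
    (D := fun x x' : Tor (fine (R * N) M) × Fin d => (tdist (par N R M x.1) (par N R M x'.1) : ℝ))
    (by positivity : (0 : ℝ) ≤ 2 / γK) hrF0.le hG (fun b => sum_abs_fromRows_row N R M ι b)
    (fun b x b' x' hb hb' => tdist_key_le_tdist_par_add_two N R M ι hb hb') b b'
  rw [hc₀]
  calc _ ≤ (1 : ℝ) ^ 2 * (2 / γK) * Real.exp (rF * 2) * Real.exp (-(rF *
        (tdist (Sum.elim (fun b : Tor (fine N M) × Fin d => b.1) (fun t : T => par N R M (ι t).1) b)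
               (Sum.elim (fun b : Tor (fine N M) × Fin d => b.1) (fun t : T => par N R M (ι t).1) b') : ℝ))) := h
    _ = _ := by rw [one_pow, one_mul, mul_comm rF 2]

/-- **`abs_inv_mul_transpose_le_QB_axial` — THE SOFT COLUMNS `K⁻¹Q_axᵀ` ARE LOCALISED**: `|(K⁻¹Q_axᵀ)(x,b)| ≤ (2∕γ_K)e^{r_F}·e^{−r_F·tdist(par x, key b)}` (PART 105 §4 with `q₁ = 1`,
`R′ = 1`). [folklore] -/
theorem abs_inv_mul_transpose_le_QB_axial (hKf0 : ∀ s : ℝ, 0 < s → 0 ≤ Kf s)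
    (hKf : ∀ s : ℝ, 0 < s → ∀ y : Tor (fine N M), ∑ y' : Tor (fine N M), Real.exp (-(s * (tdist y y' : ℝ))) ≤ Kf s)
    (hH : Hᵀ = H) {γK : ℝ} (hγK : 0 < γK) {a h₀ δH : ℝ} (ha : 0 < a) (hh₀ : 0 ≤ h₀) (hδH : 0 < δH)
    (hK : QGQInverse.Coercive
      (H + (Matrix.fromRows (reM (QB N R M)) (fun (t : T) (x : Tor (fine (R * N) M) × Fin d) => if x = ι t then (1 : ℝ) else 0))ᵀ
          * (a • (1 : Matrix ((Tor (fine N M) × Fin d) ⊕ T) ((Tor (fine N M) × Fin d) ⊕ T) ℝ))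
          * Matrix.fromRows (reM (QB N R M)) (fun (t : T) (x : Tor (fine (R * N) M) × Fin d) => if x = ι t then (1 : ℝ) else 0)) γK)
    (hHent : ∀ x x', |H x x'| ≤ h₀ * Real.exp (-(δH * (tdist (par N R M x.1) (par N R M x'.1) : ℝ))))
    {cK rF c₁ : ℝ} (hcK : cK = (h₀ + a * (((R : ℝ) ^ d)⁻¹ * ((R : ℝ) ^ d)⁻¹) * Real.exp (2 * δH)) + a)
    (hrF : rF = rate (fun s => (d : ℝ) * (R : ℝ) ^ d * Kf s) γK cK δH) (hc₁ : c₁ = 2 / γK * Real.exp rF)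
    (x : Tor (fine (R * N) M) × Fin d) (b : (Tor (fine N M) × Fin d) ⊕ T) :
    |((H + (Matrix.fromRows (reM (QB N R M)) (fun (t : T) (x : Tor (fine (R * N) M) × Fin d) => if x = ι t then (1 : ℝ) else 0))ᵀ
          * (a • (1 : Matrix ((Tor (fine N M) × Fin d) ⊕ T) ((Tor (fine N M) × Fin d) ⊕ T) ℝ))
          * Matrix.fromRows (reM (QB N R M)) (fun (t : T) (x : Tor (fine (R * N) M) × Fin d) => if x = ι t then (1 : ℝ) else 0))⁻¹
        * (Matrix.fromRows (reM (QB N R M)) (fun (t : T) (x : Tor (fine (R * N) M) × Fin d) => if x = ι t then (1 : ℝ) else 0))ᵀ) x b| ≤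
      c₁ * Real.exp (-(rF * (tdist (par N R M x.1) (Sum.elim (fun b : Tor (fine N M) × Fin d => b.1) (fun t : T => par N R M (ι t).1) b) : ℝ))) := by
  have hcK0 : 0 ≤ cK := by rw [hcK]; positivity
  have hprof : ∀ s : ℝ, 0 < s → 0 ≤ (d : ℝ) * (R : ℝ) ^ d * Kf s := fun s hs => by have := hKf0 s hs; positivity
  have hrF0 : 0 < rF := by rw [hrF]; exact rate_pos hprof hγK hcK0 hδH
  have hG := abs_inv_regFormAx_le N R M ι hKf0 hKf hH hγK ha hh₀ hδH hK hHent hcK hrF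
  have h := abs_inv_mul_transpose_le_of_resolvent
    (σ := fun (x : Tor (fine (R * N) M) × Fin d) (b : (Tor (fine N M) × Fin d) ⊕ T) =>
      (tdist (par N R M x.1) (Sum.elim (fun b : Tor (fine N M) × Fin d => b.1) (fun t : T => par N R M (ι t).1) b) : ℝ))
    (D := fun x x' : Tor (fine (R * N) M) × Fin d => (tdist (par N R M x.1) (par N R M x'.1) : ℝ))
    (by positivity : (0 : ℝ) ≤ 2 / γK) hrF0.le hG (fun b => sum_abs_fromRows_row N R M ι b)
    (fun b' x x' hb' => tdist_par_key_le_tdist_par_add_one N R M ι x hb') x b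
  rw [hc₁]
  calc _ ≤ (1 : ℝ) * (2 / γK) * Real.exp (rF * 1) * Real.exp (-(rF *
        (tdist (par N R M x.1) (Sum.elim (fun b : Tor (fine N M) × Fin d => b.1) (fun t : T => par N R M (ι t).1) b) : ℝ))) := h
    _ = _ := by rw [one_mul, mul_one]

end Soft

/-! ## §2 The trial-form upper bound and the three ENDs -/

section End

variable {H : Matrix (Tor (fine (R * N) M) × Fin d) (Tor (fine (R * N) M) × Fin d) ℝ} {Kf : ℝ → ℝ}

omit [DecidableEq T] in
/-- **`ub_QB_axial` — PART 105's UPPER BOUND IN TRIAL FORM FOR THE STACKED CONSTRAINT**: if the family `ι` AVOIDS THE TOP CORNERS (`¬ rem(ι t) ≡ R − 1`; the axial tree does, PART 178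
`cornerLift_apply_of_tree`) and `⟨u,Hu⟩ ≤ h|u|²` (`h ≥ 0`), then every stacked datum `D` has a fine field `u` with `Q_ax·u = D` and `⟨u,Hu⟩ ≤ h·e₂·|D|²`, `e₂ = 4R^{2d}(1 + R^{−d}) + 2·1`
(PART 177's stacked lift: corner lift + zero-extension). [folklore] -/
theorem ub_QB_axial (hι : ∀ t : T, ¬ (∀ ν, ((rem N R M (ι t).1 ν : ℕ)) = R - 1)) {h : ℝ} (hh : 0 ≤ h) (hHub : ∀ u, u ⬝ᵥ (H *ᵥ u) ≤ h * (u ⬝ᵥ u))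
    (D : (Tor (fine N M) × Fin d) ⊕ T → ℝ) :
    ∃ u : Tor (fine (R * N) M) × Fin d → ℝ,
      Matrix.fromRows (reM (QB N R M)) (fun (t : T) (x : Tor (fine (R * N) M) × Fin d) => if x = ι t then (1 : ℝ) else 0) *ᵥ u = D ∧
        u ⬝ᵥ (H *ᵥ u) ≤ h * (4 * ((R : ℝ) ^ d) ^ 2 * (1 + ((R : ℝ) ^ d)⁻¹) + 2 * 1) * (D ⬝ᵥ D) := by
  have hR : (0 : ℝ) < R := by exact_mod_cast Nat.pos_of_ne_zero (NeZero.ne R)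
  have hQR : ∀ B : Tor (fine N M) × Fin d → ℝ, reM (QB N R M) *ᵥ
      (fun x : Tor (fine (R * N) M) × Fin d => if (∀ ν, ((rem N R M x.1 ν : ℕ)) = R - 1) then (R : ℝ) ^ d * B (par N R M x.1, x.2) else 0) = B :=
    reM_QB_mulVec_cornerLift N R M
  have hER : ∀ B : Tor (fine N M) × Fin d → ℝ, (fun (t : T) (x : Tor (fine (R * N) M) × Fin d) => if x = ι t then (1 : ℝ) else 0) *ᵥ
      (fun x : Tor (fine (R * N) M) × Fin d => if (∀ ν, ((rem N R M x.1 ν : ℕ)) = R - 1) then (R : ℝ) ^ d * B (par N R M x.1, x.2) else 0) = 0 := by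
    intro B
    funext t
    rw [proj_mulVec, Pi.zero_apply]
    exact if_neg (hι t)
  have hEE := proj_mulVec_ext ι
  have hRQ : ∀ B : Tor (fine N M) × Fin d → ℝ,
      (fun x : Tor (fine (R * N) M) × Fin d => if (∀ ν, ((rem N R M x.1 ν : ℕ)) = R - 1) then (R : ℝ) ^ d * B (par N R M x.1, x.2) else 0) ⬝ᵥ
      (fun x : Tor (fine (R * N) M) × Fin d => if (∀ ν, ((rem N R M x.1 ν : ℕ)) = R - 1) then (R : ℝ) ^ d * B (par N R M x.1, x.2) else 0)
        ≤ ((R : ℝ) ^ d) ^ 2 * (B ⬝ᵥ B) := fun B => (cornerLift_dotProduct_self N R M B).le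
  have hRE : ∀ w : T → ℝ, (fun x => ∑ t', if x = ι t' then w t' else 0) ⬝ᵥ (fun x => ∑ t', if x = ι t' then w t' else 0) ≤ 1 * (w ⬝ᵥ w) :=
    fun w => by rw [ext_dotProduct_self, one_mul]
  have hQRE := dotProduct_reM_QB_ext_le N R M ι
  refine ⟨_, fromRows_mulVec_stackedLift hQR hER hEE D, (hHub _).trans ?_⟩
  rw [mul_assoc]
  exact mul_le_mul_of_nonneg_left (stackedLift_mass (by positivity) zero_le_one (by positivity) hRQ hRE hQRE D) hh

/-- **`abs_effForm_le_QB_axial` — THE EFFECTIVE FORM OF THE STACKED ONE-STEP CONSTRAINT IS LOCALISED** [our proof; PART 105 `abs_effForm_le` with `hK` an INPUT, `hUB` := `ub_QB_axial`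
(`Λ = h·e₂`), `hP` := `abs_blockProp_le_QB_axial`, the key profile `d(1+R^d)·Kf`]: `|𝒮(b,b′)| ≤ (2(Λ+a)+a)·e^{−r_U·tdist(key b, key b′)}`. -/
theorem abs_effForm_le_QB_axial (hι : ∀ t : T, ¬ (∀ ν, ((rem N R M (ι t).1 ν : ℕ)) = R - 1)) (hKf0 : ∀ s : ℝ, 0 < s → 0 ≤ Kf s)
    (hKf : ∀ s : ℝ, 0 < s → ∀ y : Tor (fine N M), ∑ y' : Tor (fine N M), Real.exp (-(s * (tdist y y' : ℝ))) ≤ Kf s)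
    (hH : Hᵀ = H) (hpsd : ∀ z, 0 ≤ z ⬝ᵥ (H *ᵥ z)) {h : ℝ} (hh : 0 ≤ h) (hHub : ∀ u, u ⬝ᵥ (H *ᵥ u) ≤ h * (u ⬝ᵥ u)) {γK : ℝ} (hγK : 0 < γK)
    {a h₀ δH : ℝ} (ha : 0 < a) (hh₀ : 0 ≤ h₀) (hδH : 0 < δH)
    (hK : QGQInverse.Coercive
      (H + (Matrix.fromRows (reM (QB N R M)) (fun (t : T) (x : Tor (fine (R * N) M) × Fin d) => if x = ι t then (1 : ℝ) else 0))ᵀ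
          * (a • (1 : Matrix ((Tor (fine N M) × Fin d) ⊕ T) ((Tor (fine N M) × Fin d) ⊕ T) ℝ))
          * Matrix.fromRows (reM (QB N R M)) (fun (t : T) (x : Tor (fine (R * N) M) × Fin d) => if x = ι t then (1 : ℝ) else 0)) γK)
    (hHent : ∀ x x', |H x x'| ≤ h₀ * Real.exp (-(δH * (tdist (par N R M x.1) (par N R M x'.1) : ℝ))))
    {cK rF c₀ Λ rU : ℝ} (hcK : cK = (h₀ + a * (((R : ℝ) ^ d)⁻¹ * ((R : ℝ) ^ d)⁻¹) * Real.exp (2 * δH)) + a)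
    (hrF : rF = rate (fun s => (d : ℝ) * (R : ℝ) ^ d * Kf s) γK cK δH) (hc₀ : c₀ = 2 / γK * Real.exp (2 * rF))
    (hΛ : Λ = h * (4 * ((R : ℝ) ^ d) ^ 2 * (1 + ((R : ℝ) ^ d)⁻¹) + 2 * 1)) (hrU : rU = rate (fun s => (d : ℝ) * (1 + (R : ℝ) ^ d) * Kf s) (Λ + a)⁻¹ c₀ rF)
    (b b' : (Tor (fine N M) × Fin d) ⊕ T) :
    |effForm H (Matrix.fromRows (reM (QB N R M)) (fun (t : T) (x : Tor (fine (R * N) M) × Fin d) => if x = ι t then (1 : ℝ) else 0)) b b'| ≤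
      (2 * (Λ + a) + a) * Real.exp (-(rU * (tdist (Sum.elim (fun b : Tor (fine N M) × Fin d => b.1) (fun t : T => par N R M (ι t).1) b)
                                            (Sum.elim (fun b : Tor (fine N M) × Fin d => b.1) (fun t : T => par N R M (ι t).1) b') : ℝ))) := by
  have hcK0 : 0 ≤ cK := by rw [hcK]; positivity
  have hprofF : ∀ s : ℝ, 0 < s → 0 ≤ (d : ℝ) * (R : ℝ) ^ d * Kf s := fun s hs => by have := hKf0 s hs; positivity
  have hprofU : ∀ s : ℝ, 0 < s → 0 ≤ (d : ℝ) * (1 + (R : ℝ) ^ d) * Kf s := fun s hs => by have := hKf0 s hs; positivity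
  have hrF0 : 0 < rF := by rw [hrF]; exact rate_pos hprofF hγK hcK0 hδH
  have hc₀0 : 0 ≤ c₀ := by rw [hc₀]; positivity
  have hΛ0 : 0 ≤ Λ := by rw [hΛ]; positivity
  have hUB := ub_QB_axial N R M ι (H := H) hι hh hHub
  simp_rw [← hΛ] at hUB
  have hP := abs_blockProp_le_QB_axial N R M ι hKf0 hKf hH hγK ha hh₀ hδH hK hHent hcK hrF hc₀
  have hmain := abs_effForm_le hprofU (isPseudoDist_key N R M ι) (sumBound_key N R M ι hKf) hH hpsd ha hγK hK hΛ0 hUB hc₀0 hrF0 hP b b'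
  rwa [← hrU] at hmain

/-- **`abs_minOp_le_QB_axial` — THE HARD MINIMISER OF THE STACKED ONE-STEP CONSTRAINT HAS LOCALISED COLUMNS** [our proof; PART 105 `abs_minOp_le` with the same letters plus
`σ(x,b) = tdist(par x, key b)`, its `ρ`-compatibility (torus triangle inequality) and `hKQ` := `abs_inv_mul_transpose_le_QB_axial`]:
`|ℋ(x,b)| ≤ 2(Λ+a)·c₁·(d(1+R^d)Kf(m∕2))·e^{−(m∕2)·tdist(par x, key b)}`, `m = min r_F r_U`. -/
theorem abs_minOp_le_QB_axial (hι : ∀ t : T, ¬ (∀ ν, ((rem N R M (ι t).1 ν : ℕ)) = R - 1)) (hKf0 : ∀ s : ℝ, 0 < s → 0 ≤ Kf s)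
    (hKf : ∀ s : ℝ, 0 < s → ∀ y : Tor (fine N M), ∑ y' : Tor (fine N M), Real.exp (-(s * (tdist y y' : ℝ))) ≤ Kf s)
    (hH : Hᵀ = H) (hpsd : ∀ z, 0 ≤ z ⬝ᵥ (H *ᵥ z)) {h : ℝ} (hh : 0 ≤ h) (hHub : ∀ u, u ⬝ᵥ (H *ᵥ u) ≤ h * (u ⬝ᵥ u)) {γK : ℝ} (hγK : 0 < γK)
    {a h₀ δH : ℝ} (ha : 0 < a) (hh₀ : 0 ≤ h₀) (hδH : 0 < δH)
    (hK : QGQInverse.Coercive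
      (H + (Matrix.fromRows (reM (QB N R M)) (fun (t : T) (x : Tor (fine (R * N) M) × Fin d) => if x = ι t then (1 : ℝ) else 0))ᵀ
          * (a • (1 : Matrix ((Tor (fine N M) × Fin d) ⊕ T) ((Tor (fine N M) × Fin d) ⊕ T) ℝ))
          * Matrix.fromRows (reM (QB N R M)) (fun (t : T) (x : Tor (fine (R * N) M) × Fin d) => if x = ι t then (1 : ℝ) else 0)) γK)
    (hHent : ∀ x x', |H x x'| ≤ h₀ * Real.exp (-(δH * (tdist (par N R M x.1) (par N R M x'.1) : ℝ))))
    {cK rF c₀ c₁ Λ rU m : ℝ} (hcK : cK = (h₀ + a * (((R : ℝ) ^ d)⁻¹ * ((R : ℝ) ^ d)⁻¹) * Real.exp (2 * δH)) + a)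
    (hrF : rF = rate (fun s => (d : ℝ) * (R : ℝ) ^ d * Kf s) γK cK δH) (hc₀ : c₀ = 2 / γK * Real.exp (2 * rF)) (hc₁ : c₁ = 2 / γK * Real.exp rF)
    (hΛ : Λ = h * (4 * ((R : ℝ) ^ d) ^ 2 * (1 + ((R : ℝ) ^ d)⁻¹) + 2 * 1)) (hrU : rU = rate (fun s => (d : ℝ) * (1 + (R : ℝ) ^ d) * Kf s) (Λ + a)⁻¹ c₀ rF)
    (hm : m = min rF rU) (x : Tor (fine (R * N) M) × Fin d) (b : (Tor (fine N M) × Fin d) ⊕ T) :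
    |minOp H (Matrix.fromRows (reM (QB N R M)) (fun (t : T) (x : Tor (fine (R * N) M) × Fin d) => if x = ι t then (1 : ℝ) else 0)) x b| ≤
      2 * (Λ + a) * c₁ * ((d : ℝ) * (1 + (R : ℝ) ^ d) * Kf (m / 2)) *
        Real.exp (-(m / 2 * (tdist (par N R M x.1) (Sum.elim (fun b : Tor (fine N M) × Fin d => b.1) (fun t : T => par N R M (ι t).1) b) : ℝ))) := by
  have hcK0 : 0 ≤ cK := by rw [hcK]; positivity
  have hprofF : ∀ s : ℝ, 0 < s → 0 ≤ (d : ℝ) * (R : ℝ) ^ d * Kf s := fun s hs => by have := hKf0 s hs; positivity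
  have hprofU : ∀ s : ℝ, 0 < s → 0 ≤ (d : ℝ) * (1 + (R : ℝ) ^ d) * Kf s := fun s hs => by have := hKf0 s hs; positivity
  have hrF0 : 0 < rF := by rw [hrF]; exact rate_pos hprofF hγK hcK0 hδH
  have hc₀0 : 0 ≤ c₀ := by rw [hc₀]; positivity
  have hc₁0 : 0 ≤ c₁ := by rw [hc₁]; positivity
  have hΛ0 : 0 ≤ Λ := by rw [hΛ]; positivity
  have hUB := ub_QB_axial N R M ι (H := H) hι hh hHub
  simp_rw [← hΛ] at hUB
  have hP := abs_blockProp_le_QB_axial N R M ι hKf0 hKf hH hγK ha hh₀ hδH hK hHent hcK hrF hc₀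
  have hKQ := abs_inv_mul_transpose_le_QB_axial N R M ι hKf0 hKf hH hγK ha hh₀ hδH hK hHent hcK hrF hc₁
  have hmain := abs_minOp_le hprofU (isPseudoDist_key N R M ι) (sumBound_key N R M ι hKf) hH hpsd ha hγK hK hΛ0 hUB hc₀0 hrF0 hP
    (σ := fun (x : Tor (fine (R * N) M) × Fin d) (b : (Tor (fine N M) × Fin d) ⊕ T) =>
      (tdist (par N R M x.1) (Sum.elim (fun b : Tor (fine N M) × Fin d => b.1) (fun t : T => par N R M (ι t).1) b) : ℝ))
    (fun x b => Nat.cast_nonneg _)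
    (fun x b b' => by
      exact_mod_cast tdist_triangle (par N R M x.1) (Sum.elim (fun b : Tor (fine N M) × Fin d => b.1) (fun t : T => par N R M (ι t).1) b')
        (Sum.elim (fun b : Tor (fine N M) × Fin d => b.1) (fun t : T => par N R M (ι t).1) b))
    hc₁0 hrF0 hKQ x b
  rw [← hrU, ← hm] at hmain
  exact hmain

/-- **`abs_flucCov_le_QB_axial` — THE GAUGE-FIXED FLUCTUATION COVARIANCE `𝒢 = flucCov H Q_ax` (Bałaban's `C(CᵀHC)⁻¹Cᵀ`) IS LOCALISED IN THE BLOCK DISTANCE** [our proof; PART 106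
`abs_flucCov_le` with the letters of `abs_minOp_le_QB_axial`, `D ≤ σ + σ` (torus triangle inequality), `Kσ = d(1+R^d)·Kf` (`sum_exp_sigma_key_le`) and the soft letter
`abs_inv_regFormAx_le` (`C = 2∕γ_K`, `δ = r_F`)]: `|𝒢(x,x′)| ≤ (2∕γ_K + 2(Λ+a)·c₁²·(d(1+R^d)Kf(m∕2))·(d(1+R^d)Kf(m∕4)))·e^{−min r_F (m∕4)·tdist(par x, par x′)}`. -/
theorem abs_flucCov_le_QB_axial (hι : ∀ t : T, ¬ (∀ ν, ((rem N R M (ι t).1 ν : ℕ)) = R - 1)) (hKf0 : ∀ s : ℝ, 0 < s → 0 ≤ Kf s)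
    (hKf : ∀ s : ℝ, 0 < s → ∀ y : Tor (fine N M), ∑ y' : Tor (fine N M), Real.exp (-(s * (tdist y y' : ℝ))) ≤ Kf s)
    (hH : Hᵀ = H) (hpsd : ∀ z, 0 ≤ z ⬝ᵥ (H *ᵥ z)) {h : ℝ} (hh : 0 ≤ h) (hHub : ∀ u, u ⬝ᵥ (H *ᵥ u) ≤ h * (u ⬝ᵥ u)) {γK : ℝ} (hγK : 0 < γK)
    {a h₀ δH : ℝ} (ha : 0 < a) (hh₀ : 0 ≤ h₀) (hδH : 0 < δH)
    (hK : QGQInverse.Coercive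
      (H + (Matrix.fromRows (reM (QB N R M)) (fun (t : T) (x : Tor (fine (R * N) M) × Fin d) => if x = ι t then (1 : ℝ) else 0))ᵀ
          * (a • (1 : Matrix ((Tor (fine N M) × Fin d) ⊕ T) ((Tor (fine N M) × Fin d) ⊕ T) ℝ))
          * Matrix.fromRows (reM (QB N R M)) (fun (t : T) (x : Tor (fine (R * N) M) × Fin d) => if x = ι t then (1 : ℝ) else 0)) γK)
    (hHent : ∀ x x', |H x x'| ≤ h₀ * Real.exp (-(δH * (tdist (par N R M x.1) (par N R M x'.1) : ℝ))))
    {cK rF c₀ c₁ Λ rU m : ℝ} (hcK : cK = (h₀ + a * (((R : ℝ) ^ d)⁻¹ * ((R : ℝ) ^ d)⁻¹) * Real.exp (2 * δH)) + a)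
    (hrF : rF = rate (fun s => (d : ℝ) * (R : ℝ) ^ d * Kf s) γK cK δH) (hc₀ : c₀ = 2 / γK * Real.exp (2 * rF)) (hc₁ : c₁ = 2 / γK * Real.exp rF)
    (hΛ : Λ = h * (4 * ((R : ℝ) ^ d) ^ 2 * (1 + ((R : ℝ) ^ d)⁻¹) + 2 * 1)) (hrU : rU = rate (fun s => (d : ℝ) * (1 + (R : ℝ) ^ d) * Kf s) (Λ + a)⁻¹ c₀ rF)
    (hm : m = min rF rU) (x x' : Tor (fine (R * N) M) × Fin d) :
    |flucCov H (Matrix.fromRows (reM (QB N R M)) (fun (t : T) (x : Tor (fine (R * N) M) × Fin d) => if x = ι t then (1 : ℝ) else 0)) x x'| ≤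
      (2 / γK + 2 * (Λ + a) * c₁ ^ 2 * ((d : ℝ) * (1 + (R : ℝ) ^ d) * Kf (m / 2)) * ((d : ℝ) * (1 + (R : ℝ) ^ d) * Kf (m / 4))) *
        Real.exp (-(min rF (m / 4) * (tdist (par N R M x.1) (par N R M x'.1) : ℝ))) := by
  have hcK0 : 0 ≤ cK := by rw [hcK]; positivity
  have hprofF : ∀ s : ℝ, 0 < s → 0 ≤ (d : ℝ) * (R : ℝ) ^ d * Kf s := fun s hs => by have := hKf0 s hs; positivity
  have hprofU : ∀ s : ℝ, 0 < s → 0 ≤ (d : ℝ) * (1 + (R : ℝ) ^ d) * Kf s := fun s hs => by have := hKf0 s hs; positivity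
  have hrF0 : 0 < rF := by rw [hrF]; exact rate_pos hprofF hγK hcK0 hδH
  have hc₀0 : 0 ≤ c₀ := by rw [hc₀]; positivity
  have hc₁0 : 0 ≤ c₁ := by rw [hc₁]; positivity
  have hΛ0 : 0 ≤ Λ := by rw [hΛ]; positivity
  have hUB := ub_QB_axial N R M ι (H := H) hι hh hHub
  simp_rw [← hΛ] at hUB
  have hP := abs_blockProp_le_QB_axial N R M ι hKf0 hKf hH hγK ha hh₀ hδH hK hHent hcK hrF hc₀
  have hKQ := abs_inv_mul_transpose_le_QB_axial N R M ι hKf0 hKf hH hγK ha hh₀ hδH hK hHent hcK hrF hc₁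
  have hG := abs_inv_regFormAx_le N R M ι hKf0 hKf hH hγK ha hh₀ hδH hK hHent hcK hrF
  have hmain := abs_flucCov_le hprofU (isPseudoDist_key N R M ι) (sumBound_key N R M ι hKf) hH hpsd ha hγK hK hΛ0 hUB hc₀0 hrF0 hP
    (σ := fun (x : Tor (fine (R * N) M) × Fin d) (b : (Tor (fine N M) × Fin d) ⊕ T) =>
      (tdist (par N R M x.1) (Sum.elim (fun b : Tor (fine N M) × Fin d => b.1) (fun t : T => par N R M (ι t).1) b) : ℝ))
    (D := fun x x' : Tor (fine (R * N) M) × Fin d => (tdist (par N R M x.1) (par N R M x'.1) : ℝ))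
    (Kσ := fun s => (d : ℝ) * (1 + (R : ℝ) ^ d) * Kf s)
    (fun x b => Nat.cast_nonneg _)
    (fun x b b' => by
      exact_mod_cast tdist_triangle (par N R M x.1) (Sum.elim (fun b : Tor (fine N M) × Fin d => b.1) (fun t : T => par N R M (ι t).1) b')
        (Sum.elim (fun b : Tor (fine N M) × Fin d => b.1) (fun t : T => par N R M (ι t).1) b))
    hc₁0 hrF0 hKQ
    (fun x x' b => by
      have h1 := tdist_triangle (par N R M x.1) (Sum.elim (fun b : Tor (fine N M) × Fin d => b.1) (fun t : T => par N R M (ι t).1) b) (par N R M x'.1)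
      rw [tdist_comm (Sum.elim (fun b : Tor (fine N M) × Fin d => b.1) (fun t : T => par N R M (ι t).1) b) (par N R M x'.1)] at h1
      exact_mod_cast h1)
    (fun s hs x => sum_exp_sigma_key_le N R M ι hKf hs x) (fun x x' => Nat.cast_nonneg _) (by positivity : (0 : ℝ) ≤ 2 / γK) hG x x'
  rw [← hrU, ← hm] at hmain
  exact hmain

end End

end Summit.QuantumFields.BalabanUV.Beta.GAN24.OneStepConstraintAxialLocalisation

end
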